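import Summits.QuantumFields.BalabanUV.T4Continuum.Support.CovariantBlockReversePoincare

/-!
# T⁴ programme, spine node NE2 (U1a), lane P2 — leaf V-REG WITH BACKGROUND, file 2/3: THE SLICE COMPLEMENT `S_R(ker Q_{T′})ᗮ` OF BAŁABAN's PROJECTED
# GAUGE FUNCTIONAL WITH BACKGROUND — fields orthogonal to `ker Q_{T′}` are covariantly block-constant, so file 1's reverse Poincaré inequality applies on
# `S_R(K)ᗮ`; consequences for every 1-form `W` (unitary `R`, `T′`; in-block mismatch class `w`; NO curvature hypothesis; general finite-dimensional Hilbert `E`):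
# `n²·‖div_R W − Π_S div_R W‖² ≤ C₁·‖W‖²`, `n⁴·‖D_R(div_R W − Π_S div_R W)‖² ≤ C₁²·‖W‖²` (= (REG-G) for `projG`, lattice units), `n²·divSq_R ≤ n²·projG_R + C₁·‖W‖²`

NE2 formalisation swarm `b2b-balaban-t4-ne2-formalise-*`, leaf prover 03 GEN 6 (`prover-b2b-balaban-t4-ne2-formalise-leaf-03-g6-0`); journal INTENT
CLAIMS.log 2026-08-20 16:20Z «V-REG WITH BACKGROUND».  On top of file 1/3 (`CovariantBlockReversePoincare.{reversePoincare, revPC, …}`), leaf-09-g7's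
`VariationalVectorGaugeSlice.{avgOp, lapOp, sliceSub, projG}` (p221888), leaf-09-g4's `VariationalColourBochner.{ipv, nsqv, Dirv, negLapv, …}` (p215065) and
leaf-02-g4's `VariationalColourFederbush.{Qcv, cDv}` (p214930) — BY NAME.

THE MATHEMATICS ([folklore]).
 * §1 `nsqv_negLapv_le`: under file 1's hypotheses also `n⁴·‖div_R D_R u‖² ≤ C₁²·‖u‖²` (the covariant Laplacian is `O(n⁻²)` on the block-harmonic complement).
 * §2 `K = ker Q_{T′}` (unitary `T′`): **`eq_transport_blockConst_of_orth_ker`** — a field `ℓ²`-orthogonal to `ker Q_{T′}` IS `x ↦ T′(x)⋆ (Q_{T′} f)(block x)`;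
   hence its norm is block-constant (`norm_eq_of_orth_ker`) and its in-block covariant differences are the road's MISMATCH CLASS
   `‖R(x,μ)∘T′(x+e_μ)⋆∘T′(x) − 1‖ ≤ w` (`inBlock_lip_of_orth_ker`; the `hw` of `VariationalVectorPoincare` ∕ `VariationalVectorRegularityRho` §4, verbatim).
 * §3 **`ipv_lapOp_eq_zero_of_mem_orthogonal`**: `v ∈ S_R(K)ᗮ ⟹ div_R D_R v ⊥ K`; the slice component `projDiv R K W := Π_{S_R(K)}(div_R W)` as a field
   (`projG R K W = nsqv (projDiv R K W)`), Pythagoras `divSq = projG + nsqv (div_R W − projDiv W)`, the pairing identity `nsqv (div_R W − projDiv W) =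
   Re Σ_μ ⟪D_μ(div_R W − projDiv W), W_μ⟫`, and the three consequences **`nsqv_orthDiv_le`**, **`nsqV_cDv_orthDiv_le`**, **`divSq_le_projG_add`** with
   `C₁ = revPC d n w = 4d·36^d·(1 + n·w)²`.
File 3/3 (`VariationalVectorRegularityCovariant`, `E = ℂ`) turns `nsqV_cDv_orthDiv_le` into the (REG-G) binder of `hREG_rhoV` for the matrix of `projG R (ker Q_{T′})`.

HONEST FRAMING (T4-DAG p. 1).  Rung (B)+1 only — NOT infinite volume, NOT a mass gap, NOT Clay.  NE2 is NOT IN PRINT and NOT proved here.  MODEL LEVEL: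
transports `R`, `T′` and `K` are DATA (c5).  OURS and elementary ([folklore]); nothing printed is a hypothesis; one data `def` (`projDiv`); no `def … : Prop`;
no `sorry`; axioms standard.  LOCATED NON-CONSEQUENCE (stated, not hidden): `divSq ≤ projG + C₁n⁻²·nsqV` does NOT give the coercivity (GF3)∕V-P of `projG`
with background (`C₁ × (rough Poincaré constant) ≳ 1`; (GF3) needs the complementarity of block averages and block-harmonic modes = the covariant (1.90),
OPEN).  V-END ∕ NE2 NOT proved; NE3 OPEN; spine PROVED 0∕9.  HONEST DEPENDENCY (cell, verbatim): continuum YM on T⁴ ⇐ BetaPertH ∧ nine spine estimates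
(0/9 proved); BetaPertH ⇐ (D1) ∧ (D4) ∧ CAP+tail; G-an2-4 gates asym, D1 and NE2/3/4.
-/

noncomputable section

namespace Summit.QuantumFields.BalabanUV.T4Continuum.CovariantSliceComplement

open Finset WithLp
open scoped InnerProductSpace ComplexConjugate BigOperators
open Literature.MathematicalPhysics.QuantumFieldTheory.Balaban1983to89.B5Prop11Plancherel (Tor fine unitVec)
open Literature.MathematicalPhysics.QuantumFieldTheory.Balaban1983to89.B5Block118 (bpt)
open Literature.MathematicalPhysics.QuantumFieldTheory.Balaban1983to89.B5Blocks16 (blockOf blockOf_bpt sum_blocks)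
open Summit.QuantumFields.BalabanUV.T4Continuum.VariationalColourFederbush (cDv Qcv)
open Summit.QuantumFields.BalabanUV.T4Continuum.VariationalColourBochner
  (Dirv DirAdjv negLapv nsqv nsqv_nonneg ipv ipv_self ipv_sum_right ipv_DirAdjv inner_star_apply)
open Summit.QuantumFields.BalabanUV.T4Continuum.VariationalVectorWeitzenbock (divV divSq nsqV_eq_sum_nsqv)
open Summit.QuantumFields.BalabanUV.T4Continuum.VariationalVectorGaugeSlice
  (avgOp avgOp_apply lapOp lapOp_eq_negLapv sliceSub mem_sliceSub projG norm_toLp_sq)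
open Summit.QuantumFields.BalabanUV.T4Continuum.VectorBlockTrialForm (nsqV nsqV_nonneg)
open Summit.QuantumFields.BalabanUV.T4Continuum.ScalarBlockTrialFunction (beta1 beta1_ge)
open Summit.QuantumFields.BalabanUV.T4Continuum.CovariantBlockReversePoincare

variable {d : ℕ}
variable {E : Type*} [NormedAddCommGroup E] [InnerProductSpace ℂ E] [CompleteSpace E]

/-! ## §1 The covariant Laplacian on the block-harmonic complement -/

section Laplacian

variable (n : ℕ) [NeZero n] (M : Fin d → ℕ) [hM : ∀ μ, NeZero (M μ)]

/-- the LAPLACIAN is small on such `u` as well: `n⁴·nsqv (div_R D_R u) ≤ C₁²·nsqv u`. [folklore] -/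
theorem nsqv_negLapv_le {R : Tor (fine n M) → Fin d → (E →L[ℂ] E)} (hR : ∀ x μ, ‖R x μ‖ ≤ 1) {u : Tor (fine n M) → E} {G : Tor M → ℝ} {w : ℝ}
    (hw : 0 ≤ w) (hG : ∀ x, ‖negLapv (fine n M) R u x‖ = G (blockOf n M x))
    (hlip : ∀ (x : Tor (fine n M)) (μ : Fin d), blockOf n M (x + unitVec (fine n M) μ) = blockOf n M x →
      ‖R x μ (negLapv (fine n M) R u (x + unitVec (fine n M) μ)) - negLapv (fine n M) R u x‖ ≤ w * ‖negLapv (fine n M) R u x‖) :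
    (n : ℝ) ^ 4 * nsqv (fine n M) (negLapv (fine n M) R u) ≤ revPC d n w ^ 2 * nsqv (fine n M) u := by
  have hn : (0 : ℝ) < n := by exact_mod_cast Nat.pos_of_ne_zero (NeZero.ne n)
  set f := negLapv (fine n M) R u with hf
  set A : ℝ := ∑ μ, nsqv (fine n M) (Dirv (fine n M) R μ u) with hA
  set F : ℝ := nsqv (fine n M) f with hF
  set U : ℝ := nsqv (fine n M) u with hU
  set b : ℝ := 2 * Real.sqrt d * ((n : ℝ)⁻¹ + w) with hb
  have hA0 : 0 ≤ A := sum_nonneg fun μ _ => nsqv_nonneg _ _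
  have hF0 : 0 ≤ F := nsqv_nonneg _ _
  have hU0 : 0 ≤ U := nsqv_nonneg _ _
  have hb0 : 0 ≤ b := by positivity
  have hb2 : b ^ 2 = 4 * d * ((n : ℝ)⁻¹ + w) ^ 2 := by
    rw [hb, mul_pow, mul_pow, Real.sq_sqrt (Nat.cast_nonneg d)]; ring
  have hβd : 0 < beta1 n ^ d := pow_pos (beta1_ge n).2 d
  have hC := revPC_nonneg (d := d) n w
  have hD : Real.sqrt (∑ μ, nsqv (fine n M) (Dirv (fine n M) R μ (bumped n M f))) ≤ b * Real.sqrt F := by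
    have h := sum_nsqv_Dirv_bumped_le n M hR hw hlip
    have e : 4 * (d : ℝ) * ((n : ℝ)⁻¹ + w) ^ 2 * F = (b * Real.sqrt F) ^ 2 := by
      rw [mul_pow, Real.sq_sqrt hF0, hb2]
    rw [← hF, e] at h
    exact (Real.sqrt_le_sqrt h).trans (by rw [Real.sqrt_sq (by positivity)])
  have h1 : beta1 n ^ d * F ≤ b * Real.sqrt F * Real.sqrt A := by
    have h := re_ipv_negLapv_le (fine n M) R (bumped n M f) u
    rw [← hf, re_ipv_bumped n M hG] at h
    exact h.trans (mul_le_mul_of_nonneg_right hD (Real.sqrt_nonneg _))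
  have h1' : (beta1 n ^ d) ^ 2 * F ≤ b ^ 2 * A := sq_mul_le_of_le_sqrt hβd hF0 hA0 h1
  have hF' : F ≤ 4 * d * ((n : ℝ)⁻¹ + w) ^ 2 / (beta1 n ^ d) ^ 2 * A := by
    rw [div_mul_eq_mul_div, le_div_iff₀ (by positivity), ← hb2]; linarith [h1']
  have hF'' : F ≤ revPC d n w * ((n : ℝ) ^ 2)⁻¹ * A := hF'.trans (mul_le_mul_of_nonneg_right (sharp_le_revPC n hw) hA0)
  have hA' : (n : ℝ) ^ 2 * A ≤ revPC d n w * U := reversePoincare n M hR hw hG hlip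
  calc (n : ℝ) ^ 4 * F ≤ (n : ℝ) ^ 4 * (revPC d n w * ((n : ℝ) ^ 2)⁻¹ * A) := mul_le_mul_of_nonneg_left hF'' (by positivity)
    _ = revPC d n w * ((n : ℝ) ^ 2 * A) := by field_simp
    _ ≤ revPC d n w * (revPC d n w * U) := mul_le_mul_of_nonneg_left hA' hC
    _ = revPC d n w ^ 2 * U := by ring

end Laplacian

/-! ## §2 `K = ker Q_{T′}`: fields orthogonal to the kernel of the transported block average are covariantly block-constant -/

section Kernel

variable (n : ℕ) [NeZero n] (M : Fin d → ℕ) [hM : ∀ μ, NeZero (M μ)]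

/-- the transported average of a covariantly block-constant field: `Q_{T′}(x ↦ T′(x)⋆ G(block x)) = G` (unitary `T′`). [folklore] -/
theorem Qcv_transport_blockConst {T' : Tor (fine n M) → (E →L[ℂ] E)} (hT' : ∀ x, T' x ∈ unitary (E →L[ℂ] E)) (G : Tor M → E) :
    Qcv n M T' (fun x => star (T' x) (G (blockOf n M x))) = G := by
  have hn : ((n : ℂ) ^ d) ≠ 0 := pow_ne_zero _ (by exact_mod_cast NeZero.ne n)
  funext y
  unfold Qcv
  have h : ∀ j : Fin d → Fin n, T' (bpt n M y j) (star (T' (bpt n M y j)) (G (blockOf n M (bpt n M y j)))) = G y := by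
    intro j
    rw [blockOf_bpt, ← mul_apply_eq_comp, Unitary.mul_star_self_of_mem (hT' _), one_apply_eq_self]
  simp only [h, sum_const, card_univ, Fintype.card_fun, Fintype.card_fin]
  rw [← Nat.cast_smul_eq_nsmul ℂ (n ^ d) (G y), Nat.cast_pow, smul_smul, inv_mul_cancel₀ hn, one_smul]

/-- pairing a field against a covariantly block-constant one: `⟪k, T′⋆G∘block⟫ = Σ_y ⟪n^d·(Q_{T′}k)(y), G y⟫`. [folklore] -/
theorem ipv_transport_blockConst (T' : Tor (fine n M) → (E →L[ℂ] E)) (k : Tor (fine n M) → E) (G : Tor M → E) :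
    ipv (fine n M) k (fun x => star (T' x) (G (blockOf n M x))) = ∑ y, ⟪((n : ℂ) ^ d) • Qcv n M T' k y, G y⟫_ℂ := by
  have hn : ((n : ℂ) ^ d) ≠ 0 := pow_ne_zero _ (by exact_mod_cast NeZero.ne n)
  unfold ipv
  rw [sum_blocks n M (fun x => ⟪k x, star (T' x) (G (blockOf n M x))⟫_ℂ)]
  refine sum_congr rfl fun y _ => ?_
  simp only [blockOf_bpt, inner_star_apply]
  rw [← sum_inner]
  congr 1
  unfold Qcv
  rw [smul_smul, mul_inv_cancel₀ hn, one_smul]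

/-- **FIELDS ORTHOGONAL TO `ker Q_{T′}` ARE COVARIANTLY BLOCK-CONSTANT** (unitary `T′`): if `⟪k, f⟫ = 0` for every `k` with `Q_{T′} k = 0` then
`f = x ↦ T′(x)⋆ (Q_{T′} f)(block x)`. [folklore] -/
theorem eq_transport_blockConst_of_orth_ker {T' : Tor (fine n M) → (E →L[ℂ] E)} (hT' : ∀ x, T' x ∈ unitary (E →L[ℂ] E)) {f : Tor (fine n M) → E}
    (hf : ∀ k : Tor (fine n M) → E, Qcv n M T' k = 0 → ipv (fine n M) k f = 0) :
    f = fun x => star (T' x) (Qcv n M T' f (blockOf n M x)) := by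
  set G := Qcv n M T' f with hG
  set g : Tor (fine n M) → E := fun x => star (T' x) (G (blockOf n M x)) with hg
  have hQg : Qcv n M T' g = G := Qcv_transport_blockConst n M hT' G
  have hk : Qcv n M T' (f - g) = 0 := by
    have h := (avgOp n M T').map_sub f g
    simp only [avgOp_apply] at h
    rw [h, hQg, hG, sub_self]
  have h1 : ipv (fine n M) (f - g) f = 0 := hf _ hk
  have h2 : ipv (fine n M) (f - g) g = 0 := by
    show ipv (fine n M) (f - g) (fun x => star (T' x) (G (blockOf n M x))) = 0
    rw [ipv_transport_blockConst, hk]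
    simp only [Pi.zero_apply, smul_zero, inner_zero_left, sum_const_zero]
  have h3 : ipv (fine n M) (f - g) (f - g) = 0 := by
    have e : ipv (fine n M) (f - g) (f - g) = ipv (fine n M) (f - g) f - ipv (fine n M) (f - g) g := by
      unfold ipv; rw [← sum_sub_distrib]; exact sum_congr rfl fun x _ => inner_sub_right _ _ _
    rw [e, h1, h2, sub_zero]
  have h4 : nsqv (fine n M) (f - g) = 0 := by
    have := ipv_self (fine n M) (f - g)
    rw [h3] at this
    exact_mod_cast this.symm
  have h5 : f - g = 0 := by
    funext x
    have hx : ‖(f - g) x‖ ^ 2 = 0 := (sum_eq_zero_iff_of_nonneg fun y _ => by positivity).mp h4 x (mem_univ x)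
    simpa using hx
  exact sub_eq_zero.mp h5

/-- hence its NORM IS BLOCK-CONSTANT … [folklore] -/
theorem norm_eq_of_orth_ker {T' : Tor (fine n M) → (E →L[ℂ] E)} (hT' : ∀ x, T' x ∈ unitary (E →L[ℂ] E)) {f : Tor (fine n M) → E}
    (hf : ∀ k : Tor (fine n M) → E, Qcv n M T' k = 0 → ipv (fine n M) k f = 0) (x : Tor (fine n M)) :
    ‖f x‖ = ‖Qcv n M T' f (blockOf n M x)‖ := by
  conv_lhs => rw [eq_transport_blockConst_of_orth_ker n M hT' hf]
  exact ContinuousLinearMap.norm_map_of_mem_unitary (Unitary.star_mem (hT' x)) _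

/-- … and its IN-BLOCK covariant differences are the road's MISMATCH CLASS: `‖R(x,μ) f(x+e_μ) − f(x)‖ ≤ w·‖f x‖`. [folklore] -/
theorem inBlock_lip_of_orth_ker {T' : Tor (fine n M) → (E →L[ℂ] E)} (hT' : ∀ x, T' x ∈ unitary (E →L[ℂ] E))
    {R : Tor (fine n M) → Fin d → (E →L[ℂ] E)} {w : ℝ}
    (hw : ∀ (x : Tor (fine n M)) (μ : Fin d), blockOf n M (x + unitVec (fine n M) μ) = blockOf n M x →
      ‖R x μ * star (T' (x + unitVec (fine n M) μ)) * T' x - 1‖ ≤ w)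
    {f : Tor (fine n M) → E} (hf : ∀ k : Tor (fine n M) → E, Qcv n M T' k = 0 → ipv (fine n M) k f = 0)
    (x : Tor (fine n M)) (μ : Fin d) (hx : blockOf n M (x + unitVec (fine n M) μ) = blockOf n M x) :
    ‖R x μ (f (x + unitVec (fine n M) μ)) - f x‖ ≤ w * ‖f x‖ := by
  have hform := eq_transport_blockConst_of_orth_ker n M hT' hf
  set G := Qcv n M T' f
  have e1 : f (x + unitVec (fine n M) μ) = star (T' (x + unitVec (fine n M) μ)) (G (blockOf n M x)) := by
    conv_lhs => rw [hform]
    simp only [hx]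
  have e2 : f x = star (T' x) (G (blockOf n M x)) := by conv_lhs => rw [hform]
  have e3 : R x μ (f (x + unitVec (fine n M) μ)) - f x = (R x μ * star (T' (x + unitVec (fine n M) μ)) * T' x - 1) (f x) := by
    rw [e1, sub_apply, one_apply_eq_self, mul_apply_eq_comp, mul_apply_eq_comp, e2,
      ← mul_apply_eq_comp (T' x) (star (T' x)), Unitary.mul_star_self_of_mem (hT' x), one_apply_eq_self]
  rw [e3]
  exact (ContinuousLinearMap.le_opNorm _ _).trans (mul_le_mul_of_nonneg_right (hw x μ hx) (norm_nonneg _))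

end Kernel

/-! ## §3 The slice complement `S_R(K)ᗮ` and the consequences for a 1-form -/

section Slice

variable (n : ℕ) [NeZero n] (M : Fin d → ℕ) [hM : ∀ μ, NeZero (M μ)]
variable (N : Fin d → ℕ) [∀ μ, NeZero (N μ)]

/-- **`v ∈ S_R(K)ᗮ ⟹ div_R D_R v ⊥ K`** (the slice subspace is `div_R D_R (K)` and `div_R D_R` is symmetric). [folklore] -/
theorem ipv_lapOp_eq_zero_of_mem_orthogonal (R : Tor N → Fin d → (E →L[ℂ] E)) (K : Submodule ℂ (Tor N → E)) {v : PiLp 2 (fun _ : Tor N => E)}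
    (hv : v ∈ (sliceSub N R K)ᗮ) {k : Tor N → E} (hk : k ∈ K) : ipv N k (lapOp N R (ofLp v)) = 0 := by
  rw [Submodule.mem_orthogonal] at hv
  have h := hv (toLp 2 (lapOp N R k)) ((mem_sliceSub N _).mpr (Submodule.mem_map_of_mem hk))
  rw [PiLp.inner_apply] at h
  rw [lapOp_eq_negLapv, ipv_negLapv_comm, ← lapOp_eq_negLapv]
  exact h

variable [FiniteDimensional ℂ E]

/-- **the slice component of the divergence** `projDiv R K W := Π_{S_R(K)} (div_R W)` read back as a field (so that `projG R K W = nsqv (projDiv R K W)`). [folklore] -/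
def projDiv (R : Tor N → Fin d → (E →L[ℂ] E)) (K : Submodule ℂ (Tor N → E)) (W : Tor N → Fin d → E) : Tor N → E :=
  ofLp ((sliceSub N R K).starProjection (toLp 2 (divV N R W)))

/-- `projG R K W = nsqv (projDiv R K W)`. [folklore] -/
theorem projG_eq_nsqv_projDiv (R : Tor N → Fin d → (E →L[ℂ] E)) (K : Submodule ℂ (Tor N → E)) (W : Tor N → Fin d → E) :
    projG N R K W = nsqv N (projDiv N R K W) := by
  unfold projG projDiv nsqv
  rw [PiLp.norm_sq_eq_of_L2]

/-- the complementary component `div_R W − projDiv W` lies in `S_R(K)ᗮ`. [folklore] -/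
theorem orthDiv_mem (R : Tor N → Fin d → (E →L[ℂ] E)) (K : Submodule ℂ (Tor N → E)) (W : Tor N → Fin d → E) :
    toLp 2 (divV N R W - projDiv N R K W) ∈ (sliceSub N R K)ᗮ := by
  unfold projDiv
  rw [toLp_sub, toLp_ofLp]
  exact Submodule.sub_starProjection_mem_orthogonal _

/-- Pythagoras: `divSq R W = projG R K W + nsqv (div_R W − projDiv W)`. [folklore] -/
theorem divSq_eq_projG_add (R : Tor N → Fin d → (E →L[ℂ] E)) (K : Submodule ℂ (Tor N → E)) (W : Tor N → Fin d → E) :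
    divSq N R W = projG N R K W + nsqv N (divV N R W - projDiv N R K W) := by
  set S := sliceSub N R K
  set v : PiLp 2 (fun _ : Tor N => E) := toLp 2 (divV N R W) with hv
  have horth : ⟪S.starProjection v, v - S.starProjection v⟫_ℂ = 0 := by
    rw [inner_eq_zero_symm]; exact Submodule.starProjection_inner_eq_zero v _ (Submodule.starProjection_apply_mem S v)
  have hpy := norm_add_sq_eq_norm_sq_add_norm_sq_of_inner_eq_zero _ _ horth
  rw [add_sub_cancel] at hpy
  have e1 : divSq N R W = ‖v‖ ^ 2 := by rw [hv, norm_toLp_sq]; rfl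
  have e2 : nsqv N (divV N R W - projDiv N R K W) = ‖v - S.starProjection v‖ ^ 2 := by
    have : v - S.starProjection v = toLp 2 (divV N R W - projDiv N R K W) := by unfold projDiv; rw [toLp_sub, toLp_ofLp]
    rw [this, norm_toLp_sq]; rfl
  have e3 : projG N R K W = ‖S.starProjection v‖ ^ 2 := rfl
  rw [e1, e3, e2, sq, sq, sq]
  exact hpy

/-- the size of the complementary component is its pairing with `W` through `D_R`: `nsqv (div_R W − projDiv W) = Re Σ_μ ⟪D_μ(div_R W − projDiv W), W_μ⟫`. [folklore] -/
theorem nsqv_orthDiv_eq_re (R : Tor N → Fin d → (E →L[ℂ] E)) (K : Submodule ℂ (Tor N → E)) (W : Tor N → Fin d → E) :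
    nsqv N (divV N R W - projDiv N R K W) = (∑ μ, ipv N (Dirv N R μ (divV N R W - projDiv N R K W)) (fun x => W x μ)).re := by
  set S := sliceSub N R K
  set v : PiLp 2 (fun _ : Tor N => E) := toLp 2 (divV N R W) with hv
  set uo := divV N R W - projDiv N R K W with huo
  have hu : v - S.starProjection v = toLp 2 uo := by rw [huo]; unfold projDiv; rw [toLp_sub, toLp_ofLp]
  -- `‖u‖² = ⟪u, v⟫` since `⟪u, Πv⟫ = 0`
  have h1 : (⟪toLp 2 uo, v⟫_ℂ) = ((nsqv N uo : ℝ) : ℂ) := by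
    have h0 : ⟪v - S.starProjection v, S.starProjection v⟫_ℂ = 0 :=
      Submodule.starProjection_inner_eq_zero v _ (Submodule.starProjection_apply_mem S v)
    have e : v = (v - S.starProjection v) + S.starProjection v := (sub_add_cancel _ _).symm
    have h5 : ‖toLp 2 uo‖ ^ 2 = nsqv N uo := by rw [norm_toLp_sq]; rfl
    conv_lhs => rw [e, ← hu]
    rw [inner_add_right, h0, add_zero, inner_self_eq_norm_sq_to_K, hu, ← h5]
    norm_cast
  -- `⟪u, div_R W⟫ = Σ_μ ⟪D_μ u, W_μ⟫`
  have h2 : (⟪toLp 2 uo, v⟫_ℂ) = ∑ μ, ipv N (Dirv N R μ uo) (fun x => W x μ) := by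
    rw [hv, PiLp.inner_apply]
    change ipv N uo (divV N R W) = _
    have hdiv : divV N R W = fun x => ∑ μ, DirAdjv N R μ (fun y => W y μ) x := rfl
    rw [hdiv, ipv_sum_right]
    exact sum_congr rfl fun μ _ => ipv_DirAdjv N R μ uo _
  rw [← h2, h1, Complex.ofReal_re]

omit [InnerProductSpace ℂ E] [CompleteSpace E] [FiniteDimensional ℂ E] in
/-- `Σ_μ nsqv (W·μ) = nsqV W`. [folklore] -/
theorem sum_nsqv_comp_eq (W : Tor N → Fin d → E) : ∑ μ, nsqv N (fun x => W x μ) = nsqV N W := by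
  rw [nsqV_eq_sum_nsqv]; rfl

omit [CompleteSpace E] [FiniteDimensional ℂ E] in
/-- `nsqV (D_R g) = Σ_μ nsqv (D_μ g)`. [folklore] -/
theorem nsqV_cDv_eq (R : Tor N → Fin d → (E →L[ℂ] E)) (g : Tor N → E) : nsqV N (cDv N R g) = ∑ μ, nsqv N (Dirv N R μ g) := by
  rw [nsqV_eq_sum_nsqv]; rfl

/-- **CONSEQUENCE 1 — the complementary component of the divergence is small**: for `K = ker Q_{T′}` (unitary `T′`, `R`; mismatch class `w`),
`n²·nsqv (div_R W − projDiv W) ≤ C₁·nsqV W`. [folklore] -/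
theorem nsqv_orthDiv_le {T' : Tor (fine n M) → (E →L[ℂ] E)} (hT' : ∀ x, T' x ∈ unitary (E →L[ℂ] E))
    {R : Tor (fine n M) → Fin d → (E →L[ℂ] E)} (hU : ∀ x μ, R x μ ∈ unitary (E →L[ℂ] E)) {w : ℝ} (hw0 : 0 ≤ w)
    (hw : ∀ (x : Tor (fine n M)) (μ : Fin d), blockOf n M (x + unitVec (fine n M) μ) = blockOf n M x →
      ‖R x μ * star (T' (x + unitVec (fine n M) μ)) * T' x - 1‖ ≤ w)
    (W : Tor (fine n M) → Fin d → E) :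
    (n : ℝ) ^ 2 * nsqv (fine n M) (divV (fine n M) R W - projDiv (fine n M) R (LinearMap.ker (avgOp n M T')) W) ≤ revPC d n w * nsqV (fine n M) W := by
  set K := LinearMap.ker (avgOp n M T')
  set uo := divV (fine n M) R W - projDiv (fine n M) R K W with huo
  have hR : ∀ x μ, ‖R x μ‖ ≤ 1 := fun x μ => VariationalColourFederbush.norm_le_one_of_mem_unitary (hU x μ)
  -- `div_R D_R uo ⊥ K`, so §4 applies to `f := div_R D_R uo`
  have horth : ∀ k : Tor (fine n M) → E, Qcv n M T' k = 0 → ipv (fine n M) k (negLapv (fine n M) R uo) = 0 := by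
    intro k hk
    have hkK : k ∈ K := by rw [LinearMap.mem_ker, avgOp_apply, hk]
    have h := ipv_lapOp_eq_zero_of_mem_orthogonal (fine n M) R K (orthDiv_mem (fine n M) R K W) hkK
    rwa [lapOp_eq_negLapv] at h
  have hRP := reversePoincare n M hR hw0 (G := fun y => ‖Qcv n M T' (negLapv (fine n M) R uo) y‖) (norm_eq_of_orth_ker n M hT' horth)
    (inBlock_lip_of_orth_ker n M hT' hw horth)
  -- `‖uo‖² = Re Σ⟪D uo, W⟫ ≤ √(Σ‖D uo‖²)·√(nsqV W)`
  have h1 : nsqv (fine n M) uo ≤ Real.sqrt (∑ μ, nsqv (fine n M) (Dirv (fine n M) R μ uo)) * Real.sqrt (nsqV (fine n M) W) := by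
    have h := re_sum_ipv_le (fine n M) (fun μ => Dirv (fine n M) R μ uo) (fun μ x => W x μ)
    beta_reduce at h
    rw [sum_nsqv_comp_eq (fine n M) W] at h
    have e := nsqv_orthDiv_eq_re (fine n M) R K W
    rw [← huo] at e
    rw [e]
    exact h
  exact mul_le_of_sqrt_chain (nsqv_nonneg _ _) (sum_nonneg fun μ _ => nsqv_nonneg _ _) (nsqV_nonneg _ _) (revPC_nonneg n w)
    (by positivity) h1 hRP

/-- **CONSEQUENCE 2 — (REG-G) FOR `projG` WITH BACKGROUND, lattice units**: `n⁴·nsqV (D_R (div_R W − projDiv W)) ≤ C₁²·nsqV W`. [folklore] -/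
theorem nsqV_cDv_orthDiv_le {T' : Tor (fine n M) → (E →L[ℂ] E)} (hT' : ∀ x, T' x ∈ unitary (E →L[ℂ] E))
    {R : Tor (fine n M) → Fin d → (E →L[ℂ] E)} (hU : ∀ x μ, R x μ ∈ unitary (E →L[ℂ] E)) {w : ℝ} (hw0 : 0 ≤ w)
    (hw : ∀ (x : Tor (fine n M)) (μ : Fin d), blockOf n M (x + unitVec (fine n M) μ) = blockOf n M x →
      ‖R x μ * star (T' (x + unitVec (fine n M) μ)) * T' x - 1‖ ≤ w)
    (W : Tor (fine n M) → Fin d → E) :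
    (n : ℝ) ^ 4 * nsqV (fine n M) (cDv (fine n M) R (divV (fine n M) R W - projDiv (fine n M) R (LinearMap.ker (avgOp n M T')) W))
      ≤ revPC d n w ^ 2 * nsqV (fine n M) W := by
  set K := LinearMap.ker (avgOp n M T')
  set uo := divV (fine n M) R W - projDiv (fine n M) R K W with huo
  have hR : ∀ x μ, ‖R x μ‖ ≤ 1 := fun x μ => VariationalColourFederbush.norm_le_one_of_mem_unitary (hU x μ)
  have horth : ∀ k : Tor (fine n M) → E, Qcv n M T' k = 0 → ipv (fine n M) k (negLapv (fine n M) R uo) = 0 := by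
    intro k hk
    have hkK : k ∈ K := by rw [LinearMap.mem_ker, avgOp_apply, hk]
    have h := ipv_lapOp_eq_zero_of_mem_orthogonal (fine n M) R K (orthDiv_mem (fine n M) R K W) hkK
    rwa [lapOp_eq_negLapv] at h
  have hRP := reversePoincare n M hR hw0 (G := fun y => ‖Qcv n M T' (negLapv (fine n M) R uo) y‖) (norm_eq_of_orth_ker n M hT' horth)
    (inBlock_lip_of_orth_ker n M hT' hw horth)
  have hU1 := nsqv_orthDiv_le n M hT' hU hw0 hw W
  have hC := revPC_nonneg (d := d) n w
  rw [nsqV_cDv_eq]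
  calc (n : ℝ) ^ 4 * ∑ μ, nsqv (fine n M) (Dirv (fine n M) R μ uo) = (n : ℝ) ^ 2 * ((n : ℝ) ^ 2 * ∑ μ, nsqv (fine n M) (Dirv (fine n M) R μ uo)) := by
        ring
    _ ≤ (n : ℝ) ^ 2 * (revPC d n w * nsqv (fine n M) uo) := mul_le_mul_of_nonneg_left hRP (by positivity)
    _ = revPC d n w * ((n : ℝ) ^ 2 * nsqv (fine n M) uo) := by ring
    _ ≤ revPC d n w * (revPC d n w * nsqV (fine n M) W) := mul_le_mul_of_nonneg_left hU1 hC
    _ = revPC d n w ^ 2 * nsqV (fine n M) W := by ring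

/-- **CONSEQUENCE 3 — the projected functional controls the full divergence form up to a mass term**:
`n²·divSq_R W ≤ n²·projG R (ker Q_{T′}) W + C₁·nsqV W`. [folklore] -/
theorem divSq_le_projG_add {T' : Tor (fine n M) → (E →L[ℂ] E)} (hT' : ∀ x, T' x ∈ unitary (E →L[ℂ] E))
    {R : Tor (fine n M) → Fin d → (E →L[ℂ] E)} (hU : ∀ x μ, R x μ ∈ unitary (E →L[ℂ] E)) {w : ℝ} (hw0 : 0 ≤ w)
    (hw : ∀ (x : Tor (fine n M)) (μ : Fin d), blockOf n M (x + unitVec (fine n M) μ) = blockOf n M x →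
      ‖R x μ * star (T' (x + unitVec (fine n M) μ)) * T' x - 1‖ ≤ w)
    (W : Tor (fine n M) → Fin d → E) :
    (n : ℝ) ^ 2 * divSq (fine n M) R W ≤ (n : ℝ) ^ 2 * projG (fine n M) R (LinearMap.ker (avgOp n M T')) W + revPC d n w * nsqV (fine n M) W := by
  rw [divSq_eq_projG_add (fine n M) R (LinearMap.ker (avgOp n M T')) W, mul_add]
  exact add_le_add le_rfl (nsqv_orthDiv_le n M hT' hU hw0 hw W)

end Slice

end Summit.QuantumFields.BalabanUV.T4Continuum.CovariantSliceComplement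

end
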